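import Summits.QuantumFields.YangMills.Theses.LangevinControlUV
import Literature.MathematicalPhysics.QuantumFieldTheory.DiagonalLatticeClustering

/-!
# Re-type package for crux `GapToContinuum` (stmt-QuantumFields-8896) — strategist census companion

The DOOR recorded in `STRATEGY-CENSUS.md` §6, in pasteable form (tree names only; elaborates, 0 sorry):

* `GapToContinuumR` — the crux with the tree's WEAKEST transferable lattice clause
  `SpeciesScheme.HasDiagClustering` (`Literature/…/DiagonalLatticeClustering.lean`, landed) in place of
  `HasLatticeMassGap`; CLOSED by `IsYangMillsFor.hasMassGap_of_hasDiagClustering` (one line below).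
  (= lead a1's R5 with the inline clause replaced by the tree name; `Iff.rfl` recorded.)
* `OSLegsAtWeakCouplingR` — stmt-QuantumFields-16207 (`OSLegsAtWeakCouplingC`) VERBATIM with the final
  `∃ Δ > 0, HasLatticeMassGap r sch Δ` extended by `∧ sch.HasDiagClustering r Δ` (the scheme is existential
  there; the lattice clause of `YangMills` is still delivered).  It implies the current 16207 outright.
* `closes4` — the route's deciding theorem with FOUR hypotheses (GapToContinuum dropped from the cone;
  the transfer is the tree theorem); `closes5` — the same keeping a gap item `GapToContinuumR` as a
  (trivially closed) fifth hypothesis, if the planner prefers to keep the edge visible.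

Tenure commands are in the census §6.  Nothing here is proposed to the tree.
-/

noncomputable section

open scoped SchwartzMap
open MeasureTheory Filter Topology
open Literature.MathematicalPhysics.AQFT Literature.MathematicalPhysics.QuantumLattice
open Literature.MathematicalPhysics.QuantumFieldTheory Literature.Probability.LatticeModels

namespace Summit.QuantumFields.YangMills.Cruxes.GapToContinuum.StrategyCensus

open Summit.QuantumFields.YangMills.Theses.LangevinControlUV

/-- **Re-typed crux (R5, tree-named)**: `IsYangMillsFor r sch T` and diagonal clustering of the lattice
`n`-point functions on the scheme's own tori at rate `Δ` (one slab-ordered real factor datum at a time,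
free constant, slack `ε`, eventually in `k`) give the full-spectrum gap `T.HasMassGap Δ`. -/
def GapToContinuumR : Prop :=
  ∀ (G : Type) [Group G] [TopologicalSpace G] [IsTopologicalGroup G] [CompactSpace G]
    [MeasurableSpace G] [BorelSpace G] (r : LatticeRep G) (sch : SpeciesScheme (YMSpecies G))
    (T : OSData (YMSpecies G) 4) (Δ : ℝ), 0 < Δ → IsYangMillsFor r sch T →
      sch.HasDiagClustering r Δ → T.HasMassGap Δ

/-- It is a theorem of the tree (one line). -/
theorem gapToContinuumR_holds : GapToContinuumR :=
  fun _G _ _ _ _ _ _ _r _sch _T _Δ _ hYM hD => hYM.hasMassGap_of_hasDiagClustering hD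

/-- **Re-typed OS legs (16207R)**: stmt-QuantumFields-16207 verbatim, conclusion extended by
`∧ sch.HasDiagClustering r Δ`. -/
def OSLegsAtWeakCouplingR : Prop :=
  open Literature.MathematicalPhysics.QuantumFieldTheory in ∀ (G : Type) [Group G] [TopologicalSpace G] [IsTopologicalGroup G] [CompactSpace G], IsCompactSimpleLieGroup G → letI : MeasurableSpace G := borel G; haveI : BorelSpace G := ⟨rfl⟩; ∀ (r : LatticeRep G), ∀ (a : ℝ → ℝ), Continuous a → (∃ (Γ : ℝ → ℝ) (β₀ ℓ₀ c C : ℝ), 0 < ℓ₀ ∧ 0 < c ∧ (∀ β, 0 < a β) ∧ Filter.Tendsto a Filter.atTop (nhds 0) ∧ (∀ s : ℝ, 0 < s → s ≤ ℓ₀ → 0 < Γ s ∧ Γ s ≤ 1) ∧ ∀ (L : ℕ) [NeZero L] (β : ℝ), β₀ ≤ β → (L : ℝ) * a β ≤ ℓ₀ → let P : (Fin 4 → ZMod L) → Fin 4 → Fin 4 → GaugeConfig 4 L G → ℝ := fun x i j U => (r.N : ℝ) - (r.ρ (plaquetteHolonomy U x i j)).trace.re; let E : (GaugeConfig 4 L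 G → ℝ) → ℝ := fun F => wilsonExpectation (d := 4) (L := L) r.ρ β F; let cov : (GaugeConfig 4 L G → ℝ) → (GaugeConfig 4 L G → ℝ) → ℝ := fun F F' => E (fun U => F U * F' U) - E F * E F'; let dist : (Fin 4 → ZMod L) → (Fin 4 → ZMod L) → ℝ := fun x y => Real.sqrt (∑ k : Fin 4, (((x k - y k).valMinAbs : ℤ) : ℝ) ^ 2); (∀ n : ℕ, 1 ≤ n → 8 * n ≤ L → c * Γ ((n : ℝ) * a β) ≤ (n : ℝ) ^ 8 * cov (P 0 0 1) (P (Pi.single (2 : Fin 4) ((n : ℕ) : ZMod L)) 0 1) ∧ (n : ℝ) ^ 8 * cov (P 0 0 1) (P (Pi.single (2 : Fin 4) ((n : ℕ) : ZMod L)) 0 1) ≤ C * Γ ((n : ℝ) * a β)) ∧ (∀ (x y : Fin 4 → ZMod L) (i j i' j' : Fin 4), x ≠ y → i ≠ j → i' ≠ j' → |cov (P x i j) (P y i' j')| * dist x y ^ 8 ≤ C * Γ (dist x y * a β))) → (∃ (Γ₃ : ℝ → ℝ) (β₁ ℓ₁ c₃ : ℝ), 0 < ℓ₁ ∧ 0 <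 c₃ ∧ (∀ s : ℝ, 0 < s → s ≤ ℓ₁ → 0 < Γ₃ s) ∧ ∀ (L : ℕ) [NeZero L] (β : ℝ), β₁ ≤ β → (L : ℝ) * a β ≤ ℓ₁ → let P : (Fin 4 → ZMod L) → Fin 4 → Fin 4 → GaugeConfig 4 L G → ℝ := fun x i j U => (r.N : ℝ) - (r.ρ (plaquetteHolonomy U x i j)).trace.re; let E : (GaugeConfig 4 L G → ℝ) → ℝ := fun F => wilsonExpectation (d := 4) (L := L) r.ρ β F; let cov : (GaugeConfig 4 L G → ℝ) → (GaugeConfig 4 L G → ℝ) → ℝ := fun F F' => E (fun U => F U * F' U) - E F * E F'; ∀ n : ℕ, 1 ≤ n → 8 * n ≤ L → c₃ * Γ₃ ((n : ℝ) * a β) ≤ (n : ℝ) ^ 12 * |E (fun U => P 0 0 1 U * P (Pi.single (2 : Fin 4) ((n : ℕ) : ZMod L)) 0 1 U * P (Pi.single (3 : Fin 4) ((n : ℕ) : ZMod L)) 0 1 U) - E (P 0 0 1) * cov (P (Pi.single (2 : Fin 4) ((n : ℕ) : ZMod L)) 0 1) (P (Pi.single (3 : Fin 4) ((n : ℕ)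 : ZMod L)) 0 1) - E (P (Pi.single (2 : Fin 4) ((n : ℕ) : ZMod L)) 0 1) * cov (P 0 0 1) (P (Pi.single (3 : Fin 4) ((n : ℕ) : ZMod L)) 0 1) - E (P (Pi.single (3 : Fin 4) ((n : ℕ) : ZMod L)) 0 1) * cov (P 0 0 1) (P (Pi.single (2 : Fin 4) ((n : ℕ) : ZMod L)) 0 1) - E (P 0 0 1) * E (P (Pi.single (2 : Fin 4) ((n : ℕ) : ZMod L)) 0 1) * E (P (Pi.single (3 : Fin 4) ((n : ℕ) : ZMod L)) 0 1)|) → (∃ (c₁ β₂ : ℝ) (S₁ : ℝ → ℕ), 0 < c₁ ∧ ∀ A B : YMSpecies G, ∃ C : ℝ, ∀ β : ℝ, β₂ ≤ β → ∀ S n : ℕ, S₁ β ≤ S → n ≤ S → |latticeConnectedCorr r.ρ β (2 * S + 1) A.F B.F n| ≤ C * Real.exp (-(c₁ * a β * n))) → ∃ (sch : SpeciesScheme (YMSpecies G)) (T : OSData (YMSpecies G) 4), (∀ k, sch.a k = a (sch.β k)) ∧ sch.HasWeakCouplingLimit ∧ IsYangMillsFor r sch T ∧ T.IsNontrivial r.curvature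 ∧ T.IsNonGaussian r.curvature ∧ ∃ Δ > 0, HasLatticeMassGap r sch Δ ∧ sch.HasDiagClustering r Δ

/-- 16207R implies the current 16207 (drop the new conjunct). -/
theorem osLegsAtWeakCouplingC_of_R (h : OSLegsAtWeakCouplingR) : OSLegsAtWeakCouplingC := by
  intro G _ _ _ _ hG r a ha hPa hSk hCl
  obtain ⟨sch, T, hsch, hW, hYM, hNT, hNG, Δ, hΔ, hlat, -⟩ := h G hG r a ha hPa hSk hCl
  exact ⟨sch, T, hsch, hW, hYM, hNT, hNG, Δ, hΔ, hlat⟩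

/-- **Deciding theorem, option A (recommended): four cruxes**, the transfer supplied by the tree. -/
theorem closes4 (hUV : FemtoCurvatureTwoPointC) (hSkew : FemtoCurvatureSkewnessC)
    (hIR : LatticeGapInUVUnitsC) (hOS : OSLegsAtWeakCouplingR) : YangMills := by
  intro G _ _ _ _ hG
  letI : MeasurableSpace G := borel G
  haveI : BorelSpace G := ⟨rfl⟩
  obtain ⟨r⟩ := hG.2
  obtain ⟨a, ha, hPa, hSk⟩ := hSkew G hG r (hUV G hG r)
  have hCl := hIR G hG r a ha hPa
  obtain ⟨sch, T, _, hW, hYM, hNT, hNG, Δ, hΔ, hlat, hD⟩ := hOS G hG r a ha hPa hSk hCl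
  exact ⟨r, sch, T, hW, hYM, hNT, hNG, Δ, hΔ, hYM.hasMassGap_of_hasDiagClustering hD, hlat⟩

/-- **Deciding theorem, option B: five hypotheses**, keeping a (tree-closed) gap item `GapToContinuumR`
in the cone; every binder is used. -/
theorem closes5 (hUV : FemtoCurvatureTwoPointC) (hSkew : FemtoCurvatureSkewnessC)
    (hIR : LatticeGapInUVUnitsC) (hOS : OSLegsAtWeakCouplingR) (hGap : GapToContinuumR) :
    YangMills := by
  intro G _ _ _ _ hG
  letI : MeasurableSpace G := borel G
  haveI : BorelSpace G := ⟨rfl⟩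
  obtain ⟨r⟩ := hG.2
  obtain ⟨a, ha, hPa, hSk⟩ := hSkew G hG r (hUV G hG r)
  have hCl := hIR G hG r a ha hPa
  obtain ⟨sch, T, _, hW, hYM, hNT, hNG, Δ, hΔ, hlat, hD⟩ := hOS G hG r a ha hPa hSk hCl
  exact ⟨r, sch, T, hW, hYM, hNT, hNG, Δ, hΔ, hGap G r sch T Δ hΔ hYM hD, hlat⟩

/-- The typed crux is NOT implied by, and does not imply, `GapToContinuumR` (different lattice
clauses); what the route needs is only the latter.  Recorded: the typed crux would give option B's
fifth hypothesis for schemes that ALSO carry `HasDiagClustering` — vacuous bookkeeping. -/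
theorem gapToContinuumR_of_typed (_h : GapToContinuum) : GapToContinuumR := gapToContinuumR_holds

end Summit.QuantumFields.YangMills.Cruxes.GapToContinuum.StrategyCensus

end
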